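import Mathlib.Analysis.SpecialFunctions.Gaussian.PoissonSummation
import Mathlib.NumberTheory.ModularForms.JacobiTheta.TwoVariable
import Mathlib.Analysis.Complex.Basic
import HarnessLib

/-!
# The periodised Gaussian as a cosine series (Jacobi / Poisson)

For `α > 0` and real `y`, the periodisation of Regev's density `φ_α(x) = α⁻¹ exp(-π x²/α²)`
(the density of `N(0, α²/(2π))`) is the theta series

  `∑_{k ∈ ℤ} φ_α(y + k) = ∑_{n ∈ ℤ} exp(-π α² n²) cos(2π n y)`,

a real form of Jacobi's transformation formula (Mathlib's `Complex.tsum_exp_neg_quadratic`, i.e.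
Poisson summation for the Gaussian).  We also record the summability of both series and the
elementary lower bound

  `∑_{n ∈ ℤ} exp(-a n²) cos(2π n y) ≥ 1 + 2 exp(-a) cos(2π y) - 2 exp(-4a)/(1 - exp(-5a))`  (`a > 0`),

obtained by keeping the terms `|n| ≤ 1` and bounding the tail by a geometric series
(`(n+2)² ≥ 5n + 4`).  These feed the estimate `Ψ̄_α(0) ≥ (1 + 1/40)/q` of
`LWENoiseGaussianZero.lean`.

## References

* E. M. Stein, R. Shakarchi, *Fourier Analysis: An Introduction*, Princeton 2003, Ch. 5 §3
  (Poisson summation, theta function) — here through Mathlib's `Complex.tsum_exp_neg_quadratic`.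
* O. Regev, *On lattices, learning with errors, random linear codes, and cryptography*, J. ACM 56
  (2009), §2 (`Ψ_α`, `ρ_α`) [RegevLWE2009].
-/

noncomputable section

open Complex Real

namespace Literature.Computability.Cryptography

namespace LWE

/-! ### The complex Gaussian series and its real part

The `n`-th term of the theta series is `cexp (-π α² n² + 2π (i y) n)`, written out in full below
(it is Mathlib's `jacobiTheta₂_term n y (I α²)`). -/

/-- The theta term is Mathlib's `jacobiTheta₂_term n y (I α²)`. [folklore] -/
theorem thetaTermC_eq_jacobiTheta₂_term (α y : ℝ) (n : ℤ) :
    cexp (-π * ((α : ℂ) ^ 2) * (n : ℂ) ^ 2 + 2 * π * (I * y) * n) =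
      jacobiTheta₂_term n (y : ℂ) (I * (α : ℂ) ^ 2) := by
  unfold jacobiTheta₂_term
  congr 1
  ring_nf
  rw [I_sq]
  ring

/-- The theta series is summable for `α ≠ 0`. [folklore] -/
theorem summable_thetaTermC {α : ℝ} (hα : α ≠ 0) (y : ℝ) :
    Summable fun n : ℤ => cexp (-π * ((α : ℂ) ^ 2) * (n : ℂ) ^ 2 + 2 * π * (I * y) * n) := by
  rw [show (fun n : ℤ => cexp (-π * ((α : ℂ) ^ 2) * (n : ℂ) ^ 2 + 2 * π * (I * y) * n)) =
      fun n => jacobiTheta₂_term n (y : ℂ) (I * (α : ℂ) ^ 2) from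
    funext (thetaTermC_eq_jacobiTheta₂_term α y), summable_jacobiTheta₂_term_iff]
  have him : (I * (α : ℂ) ^ 2).im = α ^ 2 := by simp [sq]
  rw [him]
  positivity

/-- The real part of the theta term: `exp(-π α² n²) cos(2π n y)`. [folklore] -/
theorem thetaTermC_re (α y : ℝ) (n : ℤ) :
    (cexp (-π * ((α : ℂ) ^ 2) * (n : ℂ) ^ 2 + 2 * π * (I * y) * n)).re =
      Real.exp (-π * α ^ 2 * n ^ 2) * Real.cos (2 * π * n * y) := by
  rw [show (-π * ((α : ℂ) ^ 2) * (n : ℂ) ^ 2 + 2 * π * (I * y) * n) =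
      ((-π * α ^ 2 * n ^ 2 : ℝ) : ℂ) + ((2 * π * n * y : ℝ) : ℂ) * I by push_cast; ring,
    Complex.exp_add, ← ofReal_exp, re_ofReal_mul, exp_ofReal_mul_I_re]

/-- The cosine theta series `∑_{n ∈ ℤ} exp(-π α² n²) cos(2π n y)` is summable (`α ≠ 0`). [folklore] -/
theorem summable_thetaCos {α : ℝ} (hα : α ≠ 0) (y : ℝ) :
    Summable fun n : ℤ => Real.exp (-π * α ^ 2 * n ^ 2) * Real.cos (2 * π * n * y) := by
  have h := (Complex.hasSum_re (summable_thetaTermC hα y).hasSum).summable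
  simpa only [thetaTermC_re] using h

/-! ### Summability of the periodised Gaussian -/

/-- The shifted Gaussian `k ↦ exp(-π (y + k)²/α²)` is a constant times a Jacobi theta term:
`exp(-π(y+k)²/α²) = exp(-π y²/α²) · jacobiTheta₂_term k (i y/α²) (i/α²)` (as complex numbers).
[folklore] -/
theorem ofReal_exp_shift_eq (α y : ℝ) (k : ℤ) :
    ((Real.exp (-π * (y + k) ^ 2 / α ^ 2) : ℝ) : ℂ) =
      cexp (-π * y ^ 2 / α ^ 2) * jacobiTheta₂_term k (I * y / (α : ℂ) ^ 2) (I / (α : ℂ) ^ 2) := by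
  rw [jacobiTheta₂_term, ← Complex.exp_add, ofReal_exp]
  congr 1
  push_cast
  have : (2 * π * I * k * (I * y / (α : ℂ) ^ 2) + π * I * (k : ℂ) ^ 2 * (I / (α : ℂ) ^ 2)) =
      -(2 * π * k * y / (α : ℂ) ^ 2) - π * (k : ℂ) ^ 2 / (α : ℂ) ^ 2 := by
    ring_nf
    rw [I_sq]
    ring
  rw [this]
  ring

/-- The periodised Gaussian `∑_{k ∈ ℤ} exp(-π (y + k)²/α²)` is summable (`α ≠ 0`). [folklore] -/
theorem summable_exp_shift {α : ℝ} (hα : α ≠ 0) (y : ℝ) :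
    Summable fun k : ℤ => Real.exp (-π * (y + k) ^ 2 / α ^ 2) := by
  rw [← Complex.summable_ofReal]
  simp_rw [ofReal_exp_shift_eq]
  refine (Summable.mul_left _ ((summable_jacobiTheta₂_term_iff _ _).2 ?_))
  rw [div_eq_mul_inv, mul_im, I_re, I_im, zero_mul, one_mul, zero_add,
    show ((α : ℂ) ^ 2)⁻¹ = (((α ^ 2)⁻¹ : ℝ) : ℂ) by push_cast; ring, ofReal_re]
  positivity

/-! ### The transformation formula -/

/-- **Poisson summation for Regev's density (real form of Jacobi's transformation formula).**
For `α > 0` and real `y`,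
`∑_{k ∈ ℤ} α⁻¹ exp(-π (y + k)²/α²) = ∑_{n ∈ ℤ} exp(-π α² n²) cos(2π n y)`.
[cite: RegevLWE2009, §2] -/
theorem tsum_regevDensity_shift_eq_thetaCos {α : ℝ} (hα : 0 < α) (y : ℝ) :
    ∑' k : ℤ, α⁻¹ * Real.exp (-π * (y + k) ^ 2 / α ^ 2) =
      ∑' n : ℤ, Real.exp (-π * α ^ 2 * n ^ 2) * Real.cos (2 * π * n * y) := by
  -- Jacobi / Poisson in complex form, with `a = α²`, `b = i y`
  have ha : 0 < (((α : ℂ) ^ 2)).re := by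
    rw [show ((α : ℂ) ^ 2).re = α ^ 2 by simp [sq]]
    positivity
  have key := Complex.tsum_exp_neg_quadratic ha (I * y)
  -- the left-hand side of `key` is the theta series, whose real part is the cosine series
  have hL : (∑' n : ℤ, cexp (-π * (α : ℂ) ^ 2 * (n : ℂ) ^ 2 + 2 * π * (I * y) * n)).re =
      ∑' n : ℤ, Real.exp (-π * α ^ 2 * n ^ 2) * Real.cos (2 * π * n * y) := by
    rw [Complex.re_tsum (summable_thetaTermC hα.ne' y)]
    exact tsum_congr fun n => thetaTermC_re α y n
  -- the right-hand side of `key` is real: the periodised Gaussian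
  have hsq : ∀ n : ℤ, -π / (α : ℂ) ^ 2 * ((n : ℂ) + I * (I * y)) ^ 2 =
      ((-π * (y + (-n : ℤ)) ^ 2 / α ^ 2 : ℝ) : ℂ) := by
    intro n
    rw [show (n : ℂ) + I * (I * y) = n - y by rw [← mul_assoc, I_mul_I]; ring]
    push_cast
    ring
  have hR : (1 / ((α : ℂ) ^ 2) ^ (1 / 2 : ℂ) * ∑' n : ℤ, cexp (-π / (α : ℂ) ^ 2 * (n + I * (I * y)) ^ 2)) =
      ((∑' k : ℤ, α⁻¹ * Real.exp (-π * (y + k) ^ 2 / α ^ 2) : ℝ) : ℂ) := by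
    have hroot : ((α : ℂ) ^ 2) ^ (1 / 2 : ℂ) = α := by
      rw [show (α : ℂ) ^ 2 = ((α ^ 2 : ℝ) : ℂ) by push_cast; ring,
        show (1 / 2 : ℂ) = ((1 / 2 : ℝ) : ℂ) by push_cast; ring,
        ← ofReal_cpow (sq_nonneg α), ← Real.sqrt_eq_rpow, Real.sqrt_sq hα.le]
    rw [hroot, tsum_mul_left, ofReal_mul, ofReal_inv, one_div, ofReal_tsum]
    congr 1
    simp_rw [hsq, ← ofReal_exp]
    exact (Equiv.neg ℤ).tsum_eq (fun k : ℤ => ((Real.exp (-π * (y + k) ^ 2 / α ^ 2) : ℝ) : ℂ))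
  have := congrArg Complex.re key
  rw [hL, hR, ofReal_re] at this
  exact this.symm

/-! ### The elementary lower bound on the cosine series -/

/-- Geometric tail bound for the Gaussian tail: `∑_{n ≥ 0} exp(-a (n+2)²) ≤ exp(-4a)/(1 - exp(-5a))`
for `a > 0` (since `(n+2)² ≥ 5n + 4`). [folklore] -/
theorem tsum_exp_neg_mul_sq_add_two_le {a : ℝ} (ha : 0 < a) :
    Summable (fun n : ℕ => Real.exp (-a * ((n : ℝ) + 2) ^ 2)) ∧
    ∑' n : ℕ, Real.exp (-a * ((n : ℝ) + 2) ^ 2) ≤ Real.exp (-4 * a) / (1 - Real.exp (-5 * a)) := by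
  set r := Real.exp (-5 * a) with hr
  have hr0 : 0 ≤ r := (Real.exp_pos _).le
  have hr1 : r < 1 := by rw [hr]; exact Real.exp_lt_one_iff.2 (by linarith)
  have hgeom : HasSum (fun n : ℕ => Real.exp (-4 * a) * r ^ n) (Real.exp (-4 * a) * (1 - r)⁻¹) :=
    (hasSum_geometric_of_lt_one hr0 hr1).mul_left _
  have hle : ∀ n : ℕ, Real.exp (-a * ((n : ℝ) + 2) ^ 2) ≤ Real.exp (-4 * a) * r ^ n := by
    intro n
    rw [hr, ← Real.exp_nat_mul, ← Real.exp_add]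
    apply Real.exp_le_exp.2
    have hn : (0 : ℝ) ≤ n := n.cast_nonneg
    have hn2 : (n : ℝ) ≤ (n : ℝ) ^ 2 := by exact_mod_cast Nat.le_self_pow two_ne_zero n
    nlinarith [mul_le_mul_of_nonneg_left hn2 ha.le]
  have hnn : ∀ n : ℕ, 0 ≤ Real.exp (-a * ((n : ℝ) + 2) ^ 2) := fun n => (Real.exp_pos _).le
  have hsum : Summable (fun n : ℕ => Real.exp (-a * ((n : ℝ) + 2) ^ 2)) :=
    Summable.of_nonneg_of_le hnn hle hgeom.summable
  refine ⟨hsum, ?_⟩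
  rw [div_eq_mul_inv, ← hgeom.tsum_eq]
  exact hsum.tsum_le_tsum hle hgeom.summable

/-- **Lower bound on the cosine theta series.** For `a > 0` and real `y`,
`∑_{n ∈ ℤ} exp(-a n²) cos(2π n y) ≥ 1 + 2 exp(-a) cos(2π y) - 2 exp(-4a)/(1 - exp(-5a))`:
keep `n ∈ {-1, 0, 1}`, bound `cos ≥ -1` in the tail and sum the geometric bound of
`tsum_exp_neg_mul_sq_add_two_le`. [folklore] -/
theorem thetaCos_ge {a : ℝ} (ha : 0 < a) (y : ℝ)
    (hs : Summable fun n : ℤ => Real.exp (-a * n ^ 2) * Real.cos (2 * π * n * y)) :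
    1 + 2 * Real.exp (-a) * Real.cos (2 * π * y) - 2 * (Real.exp (-4 * a) / (1 - Real.exp (-5 * a))) ≤
      ∑' n : ℤ, Real.exp (-a * n ^ 2) * Real.cos (2 * π * n * y) := by
  set F : ℤ → ℝ := fun n => Real.exp (-a * n ^ 2) * Real.cos (2 * π * n * y) with hF
  have heven : ∀ n : ℤ, F (-n) = F n := by
    intro n
    simp only [hF, Int.cast_neg, neg_sq]
    rw [show 2 * π * -(n : ℝ) * y = -(2 * π * n * y) by ring, Real.cos_neg]
  -- summability of the two halves
  have hpos : Summable fun n : ℕ => F ((n : ℤ) + 1) :=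
    hs.comp_injective fun m n h => by simpa using h
  have hneg : Summable fun n : ℕ => F (-((n : ℤ) + 1)) := by
    simpa only [heven] using hpos
  have hsplit : ∑' n : ℤ, F n = (∑' n : ℕ, F ((n : ℤ) + 1)) + F 0 + ∑' n : ℕ, F (-((n : ℤ) + 1)) :=
    tsum_of_add_one_of_neg_add_one hpos hneg
  have hF0 : F 0 = 1 := by simp [hF]
  have hF1 : F 1 = Real.exp (-a) * Real.cos (2 * π * y) := by simp [hF]
  -- the positive half: first term plus a tail bounded below
  have hpos2 : Summable fun n : ℕ => F ((n : ℤ) + 2) :=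
    hs.comp_injective fun m n h => by simpa using h
  have htail := tsum_exp_neg_mul_sq_add_two_le ha
  have hshift : ∑' n : ℕ, F ((n : ℤ) + 1) = F 1 + ∑' n : ℕ, F ((n : ℤ) + 2) := by
    rw [hpos.tsum_eq_zero_add]
    have e1 : F (((0 : ℕ) : ℤ) + 1) = F 1 := by simp
    have e2 : (fun n : ℕ => F (((n + 1 : ℕ) : ℤ) + 1)) = fun n : ℕ => F ((n : ℤ) + 2) := by
      funext n
      exact congrArg F (by omega)
    rw [e1, e2]
  have hlow : -(Real.exp (-4 * a) / (1 - Real.exp (-5 * a))) ≤ ∑' n : ℕ, F ((n : ℤ) + 2) := by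
    refine le_trans (neg_le_neg htail.2) ?_
    rw [← tsum_neg]
    refine Summable.tsum_le_tsum (fun n => ?_) htail.1.neg hpos2
    simp only [hF]
    push_cast
    have hc := Real.neg_one_le_cos (2 * π * ((n : ℝ) + 2) * y)
    have he := (Real.exp_pos (-a * ((n : ℝ) + 2) ^ 2)).le
    nlinarith
  rw [hsplit, show (∑' n : ℕ, F (-((n : ℤ) + 1))) = ∑' n : ℕ, F ((n : ℤ) + 1) from
    tsum_congr fun n => heven _, hshift, hF0, hF1]
  linarith

end LWE

end Literature.Computability.Cryptography

end
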